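import Summits.CriticalPhenomena.PercolationContinuityZ3.Theorems.PercNearOneGluingNoHeavyLowerTailKnQuestion8ThreeOfPS5
import Summits.CriticalPhenomena.PercolationContinuityZ3.Theorems.PercNearOneGluingNoHeavyLowerTailKnQuestion8SpectatorTransfer
import HarnessLib

/-!
# Kozma–Nitzan's Question 8 at three relays — the pocket constant is a MEDIANT: reduction of (PS5) to the frame `{x, o} ↮ Y`

Support file (`--supports stmt-CriticalPhenomena-4575`, closed crux; independent mathematics on Kozma–Nitzan's Question 8,
arXiv:2401.12397 §5.5 p. 36), prover `prim-ineq-gen-7` (gen 11).  No definitions, no named facts, no sorries; standard axioms.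
Memo `run/shared/lean/prim/prim-ineq-gen-7/FINDING-PEELD-g11.md` §6(b).

`PocketCert.block41_three_of_ps5` reduces (41) at `A = {c, k, k'}` to the two-observer pocket transfer (PS5), whose constant is the ratio
`e / m` of `e = μ({k↮{c,k'}} ∩ {k↔o})` and `m = μ({k↮{c,k'}} ∩ P)`.  Both masses split along `{k'↮c} / {k'↔c}`: `e = e₁ + e₂`, `m = m₁ + m₂`.
* `PocketCert.pocket_mediant` — **(MED)** `e₂·m₁ ≤ e₁·m₂`, for an arbitrary avoided set `Y` in place of `{c}`: with `D* = {{o,v} ↮ Y ∪ {x}}`,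
  `f = {o↔v}` (increasing in `C_{{o,v}}`), `P = {C_o ∈ 𝒟}` (decreasing in `C_{{o,v}}`, `𝒟` down-closed), `g = {x↔Y}` (increasing in `C_{Y∪{x}}`):
  `μ(D*∩f∩g)·μ(D*∩P∩gᶜ) ≤ μ(D*∩f∩gᶜ)·μ(D*∩P∩g)` — four applications of van den Berg–Häggström–Kahn's Theorem 2.1 (`q = 1`) with the sets
  `S = {o, v}`, `T = Y ∪ {x}` and the cancellation `KnQ8Z.transfer_arith`.  Hence `e/m ≤ e₁/m₁` (a mediant lies below its larger term).
* `PocketCert.block41_three_of_ps5_internal` — consequently (41) at `|A| = 3` follows from the designation of `c` against `k` and `k'` and the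
  INTERNAL form of (PS5), in which both masses carry the extra condition `{k'↮c}`:
     `μ({k↮{c,k'}} ∩ {k↔o} ∩ {k'↮c}) · ∫_{P ∩ {k'↮c} ∩ {k'↔k}} (F(C k') − F(C c)) ≤ μ({k↮{c,k'}} ∩ P ∩ {k'↮c}) · ∫_{{k'↮c} ∩ {k'↔o}} (F(C k') − F(C c))`;
  every event of this inequality lies inside `{{k', o} ↮ c}`, where all of them are monotone functions of the edge cluster of `{k', o}` or of `{c}`
  (memo §6(b): the remaining five-point inequality "lives in one BHK frame"; exact census 0 / 1 200, equality on the path `c–o–k–k'`).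
[cite: VandenbergHaggstromKahn2005, Thm. 2.1 (p. 9), Remark 1 after Thm. 1.2 (p. 5)] [cite: KozmaNitzan2024, Question 8 (§5.5 p. 36), display (41)]
-/

namespace Summit.CriticalPhenomena.PercolationContinuityZ3.Theorems

open MeasureTheory Set Literature.Probability.LatticeModels Literature.Probability.Percolation
open scoped Classical
open KNPreFKG

noncomputable section

namespace PocketCert

variable {V : Type*} [Fintype V]

/-- **(MED) — the pocket constant is a mediant.**  `𝒟` down-closed; `D* = {{o,v} ↮ Y ∪ {x}}`, `f = {o↔v}`, `P = {C_o ∈ 𝒟}`, `g = {x ↔ Y}`: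
`μ(D*∩f∩g) · μ(D*∩P∩gᶜ) ≤ μ(D*∩f∩gᶜ) · μ(D*∩P∩g)`.  Four applications of van den Berg–Häggström–Kahn's Thm 2.1 (`q = 1`) with `S = {o,v}`,
`T = Y ∪ {x}`. [cite: VandenbergHaggstromKahn2005, Thm. 2.1 (p. 9)] [cite: KozmaNitzan2024, Question 8 (§5.5 p. 36)] -/
theorem pocket_mediant (w : Sym2 V → unitInterval) (o v x : V) (Y : Set V) (𝒟 : Set (Set V)) (h𝒟 : IsLowerSet 𝒟) :
    (prodBernoulli w).real ({ω : BondConfig V | ∀ s ∈ ({o, v} : Set V), ∀ t ∈ insert x Y, ¬ (openGraph ω).Reachable s t} ∩ openConn o v ∩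
          {ω | ∃ y ∈ Y, (openGraph ω).Reachable x y}) *
        (prodBernoulli w).real ({ω : BondConfig V | ∀ s ∈ ({o, v} : Set V), ∀ t ∈ insert x Y, ¬ (openGraph ω).Reachable s t} ∩
          {ω | openCluster ω o ∈ 𝒟} ∩ {ω | ∀ y ∈ Y, ¬ (openGraph ω).Reachable x y}) ≤
      (prodBernoulli w).real ({ω : BondConfig V | ∀ s ∈ ({o, v} : Set V), ∀ t ∈ insert x Y, ¬ (openGraph ω).Reachable s t} ∩ openConn o v ∩
          {ω | ∀ y ∈ Y, ¬ (openGraph ω).Reachable x y}) *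
        (prodBernoulli w).real ({ω : BondConfig V | ∀ s ∈ ({o, v} : Set V), ∀ t ∈ insert x Y, ¬ (openGraph ω).Reachable s t} ∩
          {ω | openCluster ω o ∈ 𝒟} ∩ {ω | ∃ y ∈ Y, (openGraph ω).Reachable x y}) := by
  classical
  set μ := prodBernoulli w with hμ
  have hmeas : ∀ S' : Set (BondConfig V), MeasurableSet S' := fun _ => MeasurableSet.of_discrete
  have hn := fun (S' : Set (BondConfig V)) => (measureReal_nonneg : 0 ≤ μ.real S')
  set S : Set V := {o, v} with hS
  set T : Set V := insert x Y with hT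
  set D : Set (BondConfig V) := {ω : BondConfig V | ∀ s ∈ S, ∀ t ∈ T, ¬ (openGraph ω).Reachable s t} with hD
  have hoS : o ∈ S := by simp [hS]
  have hxT : x ∈ T := mem_insert x Y
  -- functions of the edge clusters of `S` and of `T`
  set Ae : Set (Sym2 V) → ℝ := fun C => if (openGraph C).Reachable o v then 1 else 0 with hAe
  set Pe : Set (Sym2 V) → ℝ := fun C => if openCluster C o ∈ 𝒟 then 1 else 0 with hPe
  set Ge : Set (Sym2 V) → ℝ := fun C => if ∃ y ∈ Y, (openGraph C).Reachable x y then 1 else 0 with hGe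
  have hAe_mono : Monotone Ae := by
    intro C C' hCC'; simp only [hAe]
    by_cases h : (openGraph C).Reachable o v
    · rw [if_pos h, if_pos (h.mono (openGraph_mono hCC'))]
    · rw [if_neg h]; split_ifs <;> norm_num
  have hPe_anti : Antitone Pe := by
    intro C C' hCC'; simp only [hPe]
    by_cases h : openCluster C' o ∈ 𝒟
    · rw [if_pos h, if_pos (h𝒟 (openCluster_mono hCC' o) h)]
    · rw [if_neg h]; split_ifs <;> norm_num
  have hGe_mono : Monotone Ge := by
    intro C C' hCC'; simp only [hGe]
    by_cases h : ∃ y ∈ Y, (openGraph C).Reachable x y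
    · obtain ⟨y, hy, hr⟩ := h
      rw [if_pos ⟨y, hy, hr⟩, if_pos ⟨y, hy, hr.mono (openGraph_mono hCC')⟩]
    · rw [if_neg h]; split_ifs <;> norm_num
  -- the three events
  set EA : Set (BondConfig V) := openConn o v with hEA
  set EP : Set (BondConfig V) := {ω : BondConfig V | openCluster ω o ∈ 𝒟} with hEP
  set EG : Set (BondConfig V) := {ω : BondConfig V | ∃ y ∈ Y, (openGraph ω).Reachable x y} with hEG
  have hro : ∀ (ω : BondConfig V) (a : V), (openGraph (⋃ s ∈ S, openEdgeCluster ω s)).Reachable o a ↔ (openGraph ω).Reachable o a :=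
    fun ω a => (KNSep.reachable_iff_cluster ω S hoS a).symm
  have hrx : ∀ (ω : BondConfig V) (a : V), (openGraph (⋃ t ∈ T, openEdgeCluster ω t)).Reachable x a ↔ (openGraph ω).Reachable x a :=
    fun ω a => (KNSep.reachable_iff_cluster ω T hxT a).symm
  have hclo : ∀ ω : BondConfig V, openCluster (⋃ s ∈ S, openEdgeCluster ω s) o = openCluster ω o := by
    intro ω; ext a; exact hro ω a
  have hAe_eq : ∀ ω : BondConfig V, Ae (⋃ s ∈ S, openEdgeCluster ω s) = EA.indicator 1 ω := by
    intro ω; simp only [hAe, hro ω]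
    by_cases h : (openGraph ω).Reachable o v
    · rw [if_pos h, indicator_of_mem (show ω ∈ EA from h), Pi.one_apply]
    · rw [if_neg h, indicator_of_notMem (show ω ∉ EA from h)]
  have hPe_eq : ∀ ω : BondConfig V, Pe (⋃ s ∈ S, openEdgeCluster ω s) = EP.indicator 1 ω := by
    intro ω; simp only [hPe, hclo ω]
    by_cases h : openCluster ω o ∈ 𝒟
    · rw [if_pos h, indicator_of_mem (show ω ∈ EP from h), Pi.one_apply]
    · rw [if_neg h, indicator_of_notMem (show ω ∉ EP from h)]
  have hGe_eq : ∀ ω : BondConfig V, Ge (⋃ t ∈ T, openEdgeCluster ω t) = EG.indicator 1 ω := by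
    intro ω; simp only [hGe, hrx ω]
    by_cases h : ∃ y ∈ Y, (openGraph ω).Reachable x y
    · rw [if_pos h, indicator_of_mem (show ω ∈ EG from h), Pi.one_apply]
    · rw [if_neg h, indicator_of_notMem (show ω ∉ EG from h)]
  have hGc_eq : ∀ ω : BondConfig V, (1 : ℝ) - EG.indicator 1 ω = (EGᶜ : Set (BondConfig V)).indicator 1 ω := by
    intro ω
    by_cases h : ω ∈ EG
    · rw [indicator_of_mem h, indicator_of_notMem (show ω ∉ EGᶜ from fun hc => hc h), Pi.one_apply, sub_self]
    · rw [indicator_of_notMem h, indicator_of_mem (show ω ∈ EGᶜ from h), Pi.one_apply, sub_zero]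
  have indmul : ∀ (E1 E2 : Set (BondConfig V)) (ω : BondConfig V),
      E1.indicator (1 : BondConfig V → ℝ) ω * E2.indicator (1 : BondConfig V → ℝ) ω = (E1 ∩ E2).indicator (1 : BondConfig V → ℝ) ω := by
    intro E1 E2 ω
    by_cases h1e : ω ∈ E1
    · by_cases h2e : ω ∈ E2
      · rw [indicator_of_mem h1e, indicator_of_mem h2e, indicator_of_mem (show ω ∈ E1 ∩ E2 from ⟨h1e, h2e⟩)]; simp
      · rw [indicator_of_notMem h2e, indicator_of_notMem (show ω ∉ E1 ∩ E2 from fun h => h2e h.2)]; simp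
    · rw [indicator_of_notMem h1e, indicator_of_notMem (show ω ∉ E1 ∩ E2 from fun h => h1e h.1)]; simp
  have iprod : ∀ E1 E2 : Set (BondConfig V),
      ∫ ω in D, E1.indicator (1 : BondConfig V → ℝ) ω * E2.indicator (1 : BondConfig V → ℝ) ω ∂μ = μ.real (D ∩ (E1 ∩ E2)) := by
    intro E1 E2
    rw [← setIntegral_indicator_one_eq μ D (E1 ∩ E2)]
    exact setIntegral_congr_fun (hmeas D) fun ω _ => indmul E1 E2 ω
  -- (i) `f` (↑S) vs `g` (↑T): negatively correlated
  have h1 := BHK2006_twoSetConditionalAssociation w S T (fun C _ => Ae C) (fun _ C' => -Ge C')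
    (fun _ => hAe_mono) (fun _ => antitone_const) (fun _ => monotone_const) (fun _ C C' hCC' => neg_le_neg (hGe_mono hCC'))
  -- (ii) `P` (↓S) vs `gᶜ` (↓T): negatively correlated
  have h2 := BHK2006_twoSetConditionalAssociation w S T (fun C _ => -Pe C) (fun _ C' => 1 - Ge C')
    (fun _ C C' hCC' => neg_le_neg (hPe_anti hCC')) (fun _ => antitone_const) (fun _ => monotone_const)
    (fun _ C C' hCC' => sub_le_sub_left (hGe_mono hCC') 1)
  -- (iii) `P` (↓S) vs `g` (↑T): positively correlated
  have h3 := BHK2006_twoSetConditionalAssociation w S T (fun C _ => -Pe C) (fun _ C' => -Ge C')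
    (fun _ C C' hCC' => neg_le_neg (hPe_anti hCC')) (fun _ => antitone_const) (fun _ => monotone_const)
    (fun _ C C' hCC' => neg_le_neg (hGe_mono hCC'))
  -- (iv) `f` (↑S) vs `gᶜ` (↓T): positively correlated
  have h4 := BHK2006_twoSetConditionalAssociation w S T (fun C _ => Ae C) (fun _ C' => 1 - Ge C')
    (fun _ => hAe_mono) (fun _ => antitone_const) (fun _ => monotone_const) (fun _ C C' hCC' => sub_le_sub_left (hGe_mono hCC') 1)
  simp only [hAe_eq, hPe_eq, hGe_eq, hGc_eq, mul_neg, neg_mul, neg_neg, integral_neg] at h1 h2 h3 h4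
  rw [setIntegral_indicator_one_eq μ D EA, setIntegral_indicator_one_eq μ D EG, iprod EA EG] at h1
  rw [setIntegral_indicator_one_eq μ D EP, setIntegral_indicator_one_eq μ D (EGᶜ), iprod EP (EGᶜ)] at h2
  rw [setIntegral_indicator_one_eq μ D EP, setIntegral_indicator_one_eq μ D EG, iprod EP EG] at h3
  rw [setIntegral_indicator_one_eq μ D EA, setIntegral_indicator_one_eq μ D (EGᶜ), iprod EA (EGᶜ)] at h4
  -- h1 : μ(D∩EA)·(-μ(D∩EG)) ≤ μ D · (-μ(D∩(EA∩EG)))      h2 : (-μ(D∩EP))·μ(D∩EGᶜ) ≤ μ D · (-μ(D∩(EP∩EGᶜ)))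
  -- h3 : (-μ(D∩EP))·(-μ(D∩EG)) ≤ μ D · μ(D∩(EP∩EG))       h4 : μ(D∩EA)·μ(D∩EGᶜ) ≤ μ D · μ(D∩(EA∩EGᶜ))
  have key := KnQ8Z.transfer_arith (d := μ.real D) (q := μ.real (D ∩ EA)) (a := μ.real (D ∩ EGᶜ)) (b := μ.real (D ∩ EG))
    (f := μ.real (D ∩ EP)) (qb := μ.real (D ∩ (EA ∩ EG))) (qa := μ.real (D ∩ (EA ∩ EGᶜ))) (fb := μ.real (D ∩ (EP ∩ EG)))
    (fa := μ.real (D ∩ (EP ∩ EGᶜ))) (hn D) (hn _) (hn _) (hn _) (hn _) (hn _) (hn _)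
    (measureReal_mono (inter_subset_left) ) (by nlinarith [h1]) (by nlinarith [h4]) (by nlinarith [h3]) (by nlinarith [h2])
  -- rewrite the events of the statement
  have e1 : D ∩ (EA ∩ EG) = D ∩ openConn o v ∩ {ω | ∃ y ∈ Y, (openGraph ω).Reachable x y} := by rw [inter_assoc]
  have e2 : D ∩ (EP ∩ EGᶜ) = D ∩ {ω : BondConfig V | openCluster ω o ∈ 𝒟} ∩ {ω | ∀ y ∈ Y, ¬ (openGraph ω).Reachable x y} := by
    rw [inter_assoc]; congr 1; ext ω; simp [hEP, hEG]
  have e3 : D ∩ (EA ∩ EGᶜ) = D ∩ openConn o v ∩ {ω | ∀ y ∈ Y, ¬ (openGraph ω).Reachable x y} := by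
    rw [inter_assoc]; congr 1; ext ω; simp [hEA, hEG]
  have e4 : D ∩ (EP ∩ EG) = D ∩ {ω : BondConfig V | openCluster ω o ∈ 𝒟} ∩ {ω | ∃ y ∈ Y, (openGraph ω).Reachable x y} := by rw [inter_assoc]
  rw [e1, e2, e3, e4] at key
  exact key

variable {n : ℕ}

/-- **(41) at `|A| = 3` from the INTERNAL pocket transfer.**  As `block41_three_of_ps5`, but both masses of (PS5) carry the extra condition
`{k'↮c}` (so that every event lies inside `{{k',o} ↮ c}`), and the designation of `c` against BOTH other relays is used; the passage from the
internal constant to the pocket constant is (MED). [cite: KozmaNitzan2024, Question 8 (§5.5 p. 36), display (41)]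
[cite: VandenbergHaggstromKahn2005, Thm. 2.1 (p. 9)] -/
theorem block41_three_of_ps5_internal (w : Sym2 (Fin n) → unitInterval) (hw : ∀ e, w e < 1) (o c k k' : Fin n)
    (hoc : o ≠ c) (hok : o ≠ k) (hok' : o ≠ k') (hck : c ≠ k) (hck' : c ≠ k') (hkk' : k ≠ k')
    (𝒟 : Set (Set (Fin n))) (h𝒟 : IsLowerSet 𝒟) (h𝒟o : ({o} : Set (Fin n)) ∈ 𝒟)
    (hc𝒟 : ∀ W ∈ 𝒟, c ∉ W) (hk𝒟 : ∀ W ∈ 𝒟, k ∉ W) (hk'𝒟 : ∀ W ∈ 𝒟, k' ∉ W)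
    (F : Set (Fin n) → ℝ) (hF : ∀ S T : Set (Fin n), S ⊆ T → F S ≤ F T)
    (hdes : ∫ ω in {ω : BondConfig (Fin n) | openCluster ω o ∈ 𝒟}, F (openCluster ω c) ∂(prodBernoulli w) ≤
      ∫ ω in {ω : BondConfig (Fin n) | openCluster ω o ∈ 𝒟}, F (openCluster ω k) ∂(prodBernoulli w))
    (hdes' : ∫ ω in {ω : BondConfig (Fin n) | openCluster ω o ∈ 𝒟}, F (openCluster ω c) ∂(prodBernoulli w) ≤
      ∫ ω in {ω : BondConfig (Fin n) | openCluster ω o ∈ 𝒟}, F (openCluster ω k') ∂(prodBernoulli w))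
    (hPS5 : (prodBernoulli w).real ({ω : BondConfig (Fin n) | ∀ y ∈ ({c, k'} : Set (Fin n)), ¬ (openGraph ω).Reachable k y} ∩
          openConn k o ∩ {ω | ¬ (openGraph ω).Reachable k' c}) *
        ∫ ω in {ω : BondConfig (Fin n) | openCluster ω o ∈ 𝒟} ∩ {ω | ¬ (openGraph ω).Reachable k' c} ∩ openConn k' k,
          (F (openCluster ω k') - F (openCluster ω c)) ∂(prodBernoulli w) ≤
      (prodBernoulli w).real ({ω : BondConfig (Fin n) | ∀ y ∈ ({c, k'} : Set (Fin n)), ¬ (openGraph ω).Reachable k y} ∩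
          {ω | openCluster ω o ∈ 𝒟} ∩ {ω | ¬ (openGraph ω).Reachable k' c}) *
        ∫ ω in {ω : BondConfig (Fin n) | ¬ (openGraph ω).Reachable k' c} ∩ openConn k' o,
          (F (openCluster ω k') - F (openCluster ω c)) ∂(prodBernoulli w)) :
    0 ≤ ∫ ω in ⋃ a ∈ ({c, k, k'} : Finset (Fin n)), openConn o a, (F (openCluster ω o) - F (openCluster ω c)) ∂(prodBernoulli w) := by
  classical
  set μ := prodBernoulli w with hμ
  have hmeas : ∀ S : Set (BondConfig (Fin n)), MeasurableSet S := fun _ => MeasurableSet.of_discrete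
  have hn0 := fun (S' : Set (BondConfig (Fin n))) => (measureReal_nonneg : 0 ≤ μ.real S')
  have hint : ∀ (g : BondConfig (Fin n) → ℝ) (S' : Set (BondConfig (Fin n))), IntegrableOn g S' μ :=
    fun g S' => (Integrable.of_finite).integrableOn
  set gk' : BondConfig (Fin n) → ℝ := fun ω => F (openCluster ω k') - F (openCluster ω c) with hgk'
  set P : Set (BondConfig (Fin n)) := {ω : BondConfig (Fin n) | openCluster ω o ∈ 𝒟} with hP
  set N : Set (BondConfig (Fin n)) := {ω : BondConfig (Fin n) | ∀ y ∈ ({c, k'} : Set (Fin n)), ¬ (openGraph ω).Reachable k y} with hN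
  set Nc : Set (BondConfig (Fin n)) := {ω : BondConfig (Fin n) | ¬ (openGraph ω).Reachable k' c} with hNc
  set B1 := ∫ ω in Nc ∩ openConn k' o, gk' ω ∂μ with hB1
  set DP := ∫ ω in P ∩ Nc ∩ openConn k' k, gk' ω ∂μ with hDP
  -- masses and their split along `{k'↮c}` / `{k'↔c}`
  set e := μ.real (N ∩ openConn k o) with he
  set m := μ.real (N ∩ P) with hm
  set e₁ := μ.real (N ∩ openConn k o ∩ Nc) with he1
  set m₁ := μ.real (N ∩ P ∩ Nc) with hm1
  set e₂ := μ.real (N ∩ openConn k o ∩ Ncᶜ) with he2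
  set m₂ := μ.real (N ∩ P ∩ Ncᶜ) with hm2
  have hsplit : ∀ E : Set (BondConfig (Fin n)), μ.real E = μ.real (E ∩ Nc) + μ.real (E ∩ Ncᶜ) := by
    intro E
    rw [← measureReal_inter_add_sdiff (μ := μ) (s := E) (t := Nc) (hmeas Nc), sdiff_eq]
  have he_split : e = e₁ + e₂ := hsplit _
  have hm_split : m = m₁ + m₂ := hsplit _
  -- Step 1: `B₁ ≥ 0` from PEEL-D for the owner `k'`, avoided set `{c}`, and the designation against `k'`
  have hB1 : 0 ≤ B1 := by
    have hY𝒟 : ∀ W ∈ 𝒟, ∀ y ∈ ({c} : Set (Fin n)), y ∉ W := by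
      intro W hW y hy; rw [mem_singleton_iff] at hy; subst hy; exact hc𝒟 W hW
    have pd := peel_of_pocket_relay w o k' c ({c} : Set (Fin n)) (by simp) 𝒟 h𝒟 hY𝒟 F F hF hF
    have hNc' : {ω : BondConfig (Fin n) | ∀ y ∈ ({c} : Set (Fin n)), ¬ (openGraph ω).Reachable k' y} = Nc := by ext ω; simp [hNc]
    rw [hNc'] at pd
    -- ∫_{Nc ∩ P} g_{k'} = ∫_P g_{k'} ≥ 0  (on `P ∩ {k'↔c}` the integrand vanishes)
    have hPint : ∫ ω in Nc ∩ P, gk' ω ∂μ = ∫ ω in P, gk' ω ∂μ := by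
      have hpt : ∀ ω : BondConfig (Fin n), P.indicator gk' ω = (Nc ∩ P).indicator gk' ω := by
        intro ω
        by_cases hp : ω ∈ P
        · by_cases hc' : ω ∈ Nc
          · rw [indicator_of_mem hp, indicator_of_mem (show ω ∈ Nc ∩ P from ⟨hc', hp⟩)]
          · have hr : (openGraph ω).Reachable k' c := by
              by_contra h; exact hc' h
            rw [indicator_of_mem hp, indicator_of_notMem (fun h => hc' h.1), hgk']
            simp only [PreFKGSurplus.openCluster_eq_of_reach hr, sub_self]
        · rw [indicator_of_notMem hp, indicator_of_notMem (fun h => hp h.2)]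
      rw [← integral_indicator (hmeas _), ← integral_indicator (hmeas _)]
      exact integral_congr_ae (Filter.Eventually.of_forall fun ω => (hpt ω).symm)
    have hs : 0 ≤ ∫ ω in Nc ∩ P, gk' ω ∂μ := by
      rw [hPint, hgk', integral_sub (hint _ _) (hint _ _)]; linarith [hdes']
    have hposc : 0 < μ.real (Nc ∩ P) := by
      refine CSH.prodBernoulli_real_pos_of_empty_mem w hw ⟨?_, ?_⟩
      · intro hreach
        rw [SimpleGraph.reachable_iff_reflTransGen] at hreach
        rcases hreach.cases_head with h | ⟨z, hadj, -⟩
        · exact hck' h.symm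
        · exact ((openGraph_adj _ k' z).1 hadj).1
      · show openCluster (∅ : BondConfig (Fin n)) o ∈ 𝒟
        have : openCluster (∅ : BondConfig (Fin n)) o = {o} := by
          ext z
          simp only [openCluster, mem_setOf_eq, mem_singleton_iff]
          constructor
          · intro h
            rw [SimpleGraph.reachable_iff_reflTransGen] at h
            rcases h.cases_head with h | ⟨y, hadj, -⟩
            · exact h.symm
            · exact absurd ((openGraph_adj _ o y).1 hadj).1 (Set.notMem_empty _)
          · rintro rfl; exact SimpleGraph.Reachable.refl _
        rw [this]; exact h𝒟o
    -- pd : μ(Nc ∩ O') · ∫_{Nc∩P} g ≤ μ(Nc ∩ P) · B₁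
    have key : 0 ≤ μ.real (Nc ∩ P) * B1 := le_trans (mul_nonneg (hn0 _) hs) pd
    exact (mul_nonneg_iff_of_pos_left hposc).1 key
  -- Step 2: (MED)  `e₂ · m₁ ≤ e₁ · m₂`
  have hmed : e₂ * m₁ ≤ e₁ * m₂ := by
    have med := pocket_mediant w o k k' ({c} : Set (Fin n)) 𝒟 h𝒟
    -- identify the four events
    set Ds : Set (BondConfig (Fin n)) := {ω : BondConfig (Fin n) | ∀ s ∈ ({o, k} : Set (Fin n)), ∀ t ∈ insert k' ({c} : Set (Fin n)),
      ¬ (openGraph ω).Reachable s t} with hDs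
    have hP_avoid : ∀ ω ∈ P, ¬ (openGraph ω).Reachable o c ∧ ¬ (openGraph ω).Reachable o k ∧ ¬ (openGraph ω).Reachable o k' :=
      fun ω hp => ⟨fun h => hc𝒟 _ hp h, fun h => hk𝒟 _ hp h, fun h => hk'𝒟 _ hp h⟩
    have ev1 : Ds ∩ openConn o k ∩ {ω | ∃ y ∈ ({c} : Set (Fin n)), (openGraph ω).Reachable k' y} = N ∩ openConn k o ∩ Ncᶜ := by
      ext ω
      simp only [hDs, hN, hNc, mem_inter_iff, mem_setOf_eq, mem_insert_iff, mem_singleton_iff, forall_eq_or_imp, forall_eq, openConn,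
        exists_eq_left, mem_compl_iff, not_not]
      constructor
      · rintro ⟨⟨⟨⟨-, -⟩, hkk', hkc⟩, hok⟩, hk'c⟩
        exact ⟨⟨⟨hkc, hkk'⟩, hok.symm⟩, hk'c⟩
      · rintro ⟨⟨⟨hkc, hkk'⟩, hko⟩, hk'c⟩
        exact ⟨⟨⟨⟨fun h => hkk' (hko.trans h), fun h => hkc (hko.trans h)⟩, hkk', hkc⟩, hko.symm⟩, hk'c⟩
    have ev2 : Ds ∩ {ω : BondConfig (Fin n) | openCluster ω o ∈ 𝒟} ∩ {ω | ∀ y ∈ ({c} : Set (Fin n)), ¬ (openGraph ω).Reachable k' y} =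
        N ∩ P ∩ Nc := by
      ext ω
      simp only [hDs, hN, hNc, hP, mem_inter_iff, mem_setOf_eq, mem_insert_iff, mem_singleton_iff, forall_eq_or_imp, forall_eq]
      constructor
      · rintro ⟨⟨⟨⟨-, -⟩, hkk', hkc⟩, hp⟩, hk'c⟩
        exact ⟨⟨⟨hkc, hkk'⟩, hp⟩, hk'c⟩
      · rintro ⟨⟨⟨hkc, hkk'⟩, hp⟩, hk'c⟩
        exact ⟨⟨⟨⟨(hP_avoid ω hp).2.2, (hP_avoid ω hp).1⟩, hkk', hkc⟩, hp⟩, hk'c⟩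
    have ev3 : Ds ∩ openConn o k ∩ {ω | ∀ y ∈ ({c} : Set (Fin n)), ¬ (openGraph ω).Reachable k' y} = N ∩ openConn k o ∩ Nc := by
      ext ω
      simp only [hDs, hN, hNc, mem_inter_iff, mem_setOf_eq, mem_insert_iff, mem_singleton_iff, forall_eq_or_imp, forall_eq, openConn]
      constructor
      · rintro ⟨⟨⟨⟨-, -⟩, hkk', hkc⟩, hok⟩, hk'c⟩
        exact ⟨⟨⟨hkc, hkk'⟩, hok.symm⟩, hk'c⟩
      · rintro ⟨⟨⟨hkc, hkk'⟩, hko⟩, hk'c⟩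
        exact ⟨⟨⟨⟨fun h => hkk' (hko.trans h), fun h => hkc (hko.trans h)⟩, hkk', hkc⟩, hko.symm⟩, hk'c⟩
    have ev4 : Ds ∩ {ω : BondConfig (Fin n) | openCluster ω o ∈ 𝒟} ∩ {ω | ∃ y ∈ ({c} : Set (Fin n)), (openGraph ω).Reachable k' y} =
        N ∩ P ∩ Ncᶜ := by
      ext ω
      simp only [hDs, hN, hNc, hP, mem_inter_iff, mem_setOf_eq, mem_insert_iff, mem_singleton_iff, forall_eq_or_imp, forall_eq,
        exists_eq_left, mem_compl_iff, not_not]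
      constructor
      · rintro ⟨⟨⟨⟨-, -⟩, hkk', hkc⟩, hp⟩, hk'c⟩
        exact ⟨⟨⟨hkc, hkk'⟩, hp⟩, hk'c⟩
      · rintro ⟨⟨⟨hkc, hkk'⟩, hp⟩, hk'c⟩
        exact ⟨⟨⟨⟨(hP_avoid ω hp).2.2, (hP_avoid ω hp).1⟩, hkk', hkc⟩, hp⟩, hk'c⟩
    rw [ev1, ev2, ev3, ev4] at med
    simpa [he1, he2, hm1, hm2, mul_comm] using med
  -- Step 3: (PS5) for the pocket constant from the internal one
  have hm1pos : 0 < m₁ := by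
    refine CSH.prodBernoulli_real_pos_of_empty_mem w hw ⟨⟨?_, ?_⟩, ?_⟩
    · intro y hy hreach
      simp only [mem_insert_iff, mem_singleton_iff] at hy
      have hne : k ≠ y := by rcases hy with rfl | rfl <;> [exact hck.symm; exact hkk']
      rw [SimpleGraph.reachable_iff_reflTransGen] at hreach
      rcases hreach.cases_head with h | ⟨z, hadj, -⟩
      · exact hne h
      · exact ((openGraph_adj _ k z).1 hadj).1
    · show openCluster (∅ : BondConfig (Fin n)) o ∈ 𝒟
      have : openCluster (∅ : BondConfig (Fin n)) o = {o} := by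
        ext z
        simp only [openCluster, mem_setOf_eq, mem_singleton_iff]
        constructor
        · intro h
          rw [SimpleGraph.reachable_iff_reflTransGen] at h
          rcases h.cases_head with h | ⟨y, hadj, -⟩
          · exact h.symm
          · exact absurd ((openGraph_adj _ o y).1 hadj).1 (Set.notMem_empty _)
        · rintro rfl; exact SimpleGraph.Reachable.refl _
      rw [this]; exact h𝒟o
    · intro hreach
      rw [SimpleGraph.reachable_iff_reflTransGen] at hreach
      rcases hreach.cases_head with h | ⟨z, hadj, -⟩
      · exact hck' h.symm
      · exact ((openGraph_adj _ k' z).1 hadj).1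
  have hPS5' : e * DP ≤ m * B1 := by
    have he0 : 0 ≤ e := hn0 _
    have hm0 : 0 ≤ m := hn0 _
    by_cases hDP : DP ≤ 0
    · nlinarith [mul_nonneg hm0 hB1, mul_nonpos_iff.2 (Or.inl ⟨he0, hDP⟩)]
    · have hDP' : 0 < DP := lt_of_not_ge hDP
      have h5 : e₁ * DP ≤ m₁ * B1 := hPS5
      -- m₁ · (m·B₁ − e·DP) ≥ 0
      have key : m₁ * (e * DP) ≤ m₁ * (m * B1) := by
        rw [he_split, hm_split]
        nlinarith [mul_le_mul_of_nonneg_left h5 (show 0 ≤ m₁ + m₂ from by rw [← hm_split]; exact hm0),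
          mul_le_mul_of_nonneg_left hmed hDP'.le, hn0 (N ∩ P ∩ Ncᶜ), hn0 (N ∩ openConn k o ∩ Ncᶜ)]
      exact le_of_mul_le_mul_left key hm1pos
  exact block41_three_of_ps5 w hw o c k k' hoc hok hok' hck hck' hkk' 𝒟 h𝒟 h𝒟o hc𝒟 hk'𝒟 F hF hdes hPS5'

end PocketCert

end

end Summit.CriticalPhenomena.PercolationContinuityZ3.Theorems
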